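import Summits.BirchSwinnertonDyer.BirchSwinnertonDyer.Theorems.SemiOrdinaryEisensteinDescentShaTwoCochainIdeleDescent
import HarnessLib

/-!
# The Ш²-cochain bridge, step S3 (supplement): the `α/β/γ` triangle of the descent

(T13 INPUTS lane of crux Ko′ `WildKolyvaginUpperAtThree`, stmt-BirchSwinnertonDyer-20480; item CT-20191
`CasselsTateLevelInputsFact`; memos `Cruxes/WildKolyvaginUpperAtThree/SHA2-BRIDGE-w3g7.md` §1 (vi) and
`Cruxes/WildKolyvaginUpperAtThree/S3-IDELE-DESCENT-w2g11.md` §2–§3.)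

Door-c5's layer system `D : GalLayerData K` (`S = J` idèles, `S = C` idèle classes, …) carries THREE currencies for the degree-two
cohomology of a finite Galois layer `E/K`:
* `α`: `H²(Γ_K ⧸ U_E, (lim→ S)^{U_E}) = groupCohomology (D.layerRep E) 2` — door-c4's layers, where the functorial maps `j^{U_E}_*`,
  the transitions `stepG` and the class-side identity (T-C) (`…ShaTwoCochainClassInvariant.lean`) live;
* `β`: `H²(Γ_K ⧸ Γ_E, (lim→ S)^{Γ_E}) = groupCohomology (absGaloisLayerRep K E.1 (toDGM (lim→ S))) 2` — where `infTwo` starts;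
* `γ`: `H²(Gal(E/K), S_E) = groupCohomology (D.obj E) 2` — where `inv_{E/K}`, `localInv`, `ideleToClass` are computed.
`α → β` is door-c6's `LayerDelta.toAbsLayer` (the identity of vectors along `Γ_K ⧸ U_E ≅ Γ_K ⧸ Γ_E`), `α ≅ γ` is door-c5's
`D.layerCohomologyIso` (Tate VII §8 Prop. 8.1 in the limit).  The descent `ShaTwoCochain.exists_galLayer_cocycle_eq_twoCocycleClass`
(`…ShaTwoCochainIdeleDescent.lean`) is stated in the `γ`-currency only; this file EXPORTS THE TRIANGLE its proof contains, which is
the joint input of the idèle-side identification `(j)_* [Z] = infTwo (toAbsLayer ((j^{U_E})_* w))` and of (T-C):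

* `exists_layerRep_cocycle_mapCocycles₂_eq D E b₀`: every `β`-cocycle `b₀` IS, on the nose, door-c6's transport cocycle of an
  `α`-cocycle `bα` (identity of vectors); (class level: w3 g8's `ShaTwoCochain.toAbsLayer_surjective`, `…ShaTwoCochainLayerInjective.lean`, all degrees);
* `exists_layerCocycle_of_layerRepCocycle D E bα`: `∃ b, iso_E [bα] = [b] ∧ (Inf (transport bα))(σ, τ) = [b(σ|_E, τ|_E)]_E`;
* `infTwo_toAbsLayer_H2π D E bα`: `infTwo (toAbsLayer E _ 2 [bα]) = [Inf (transport bα)]` (class of the inflated cocycle);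
* `exists_galLayer_layerRep_triangle D x`: **every `x ∈ H²_cont(Γ_K, lim→ S)` is `infTwo (toAbsLayer E _ 2 w)` for a finite Galois
  layer `E` and an `α`-class `w`, together with a `γ`-cocycle `b` with `iso_E w = [b]` and a continuous representative `Z` of `x`
  with `Z(σ, τ) = [b(σ|_E, τ|_E)]_E` ON THE NOSE**; `exists_galLayer_layerRep_triangle_idele` is the case `S = J` in the binder
  shapes of `…ShaTwoCochainClassInflation.ideleSide_identification` (w5 g6) and of `…ShaTwoCochainIdeleInvariantSum` (S3b).

THEOREMS ONLY (no definition, no instance, no instance attribute, no named fact, no `sorry`).  BSD is not proved by any of this: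
these are generic transport statements for door-c5 layer systems, used by the S4 assembly of the `CasselsTateLevelInputsFact` bridge.

## References
* [SerreGaloisCohomology1997] J.-P. Serre, *Galois Cohomology* (1997), I §2.2 Proposition 8 and Corollary 1 (cohomology of a
  profinite group with discrete coefficients as the direct limit over open normal subgroups; transport of structure).
* [CasselsFrohlichANT1967] J. W. S. Cassels, A. Fröhlich (eds.), *Algebraic Number Theory* (1967), Ch. VII (J. Tate) §8 Prop. 8.1,
  §9.7, §11.1–11.2.
-/
noncomputable section

set_option linter.dupNamespace false
set_option autoImplicit false

namespace Summit.BirchSwinnertonDyer.BirchSwinnertonDyer.Theorems.ShaTwoCochain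

open CategoryTheory groupCohomology Field NumberField IsDedekindDomain
open Literature.NumberTheory.GaloisRepresentations Literature.NumberTheory.GaloisRepresentations.IdeleClassBar
open Literature.NumberTheory.GaloisRepresentations.DGMBridge Literature.NumberTheory.GaloisRepresentations.LayerDelta
open Literature.Algebra.Homology Literature.Algebra.Homology.DiscreteRep
open scoped ContRepresentation

variable {K : Type} [Field K] [NumberField K] (D : GalLayerData K) (E : GalLayer K) [Normal K E.1]

/-! ## §1 Cocycle level: a `β`-cocycle is door-c6's transport of an `α`-cocycle, on the nose -/

omit [NumberField K] in
set_option maxHeartbeats 800000 in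
-- (the rewrites in the layer-module currency are slow: as in `…IdeleDescent` §1, `…ClassInvariant` §1)
/-- **Every `2`-cocycle `b₀` of `Γ_K ⧸ Γ_E` in `(lim→ S)^{Γ_E}` is `toAbsLayer`'s cocycle map applied to a `2`-cocycle `bα` of
`Γ_K ⧸ U_E` in `(lim→ S)^{U_E}`**, namely the transport of `b₀` along `(quotEquivAbs E)⁻¹` by the identity of vectors
`(lim→ S)^{Γ_E} → (lim→ S)^{U_E}` (the inverse of door-c6's `LayerDelta.toAbsLayerHom` on vectors; Mathlib `mapCocycles₂`); the
values agree: `bα([σ]_U, [τ]_U) = b₀([σ], [τ])` as vectors of `lim→ S`.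
[cite: SerreGaloisCohomology1997, I §2.2 Proposition 8] -/
theorem exists_layerRep_cocycle_mapCocycles₂_eq [FiniteDimensional K E.1]
    (b₀ : cocycles₂ (absGaloisLayerRep K E.1 (toDGM D.toSystem.toD))) :
    ∃ bα : cocycles₂ (D.layerRep E),
      mapCocycles₂ (quotEquivAbs E).toMonoidHom (toAbsLayerHom E D.toSystem.toD) bα = b₀ := by
  -- the identity of vectors `(lim S)^{Γ_E} → (lim S)^{U_E}` as a morphism of `Γ_K ⧸ U_E`-modules (as in `…IdeleDescent` §1)
  obtain ⟨φ, hφ⟩ : ∃ φ : Rep.res (quotEquivAbs E).symm.toMonoidHom (absGaloisLayerRep K E.1 (toDGM D.toSystem.toD)) ⟶ D.layerRep E,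
      ∀ w, ((φ.hom w).1 : D.toSystem.limit) = LCarrier.val D.toSystem.toD w.1 := by
    letI := (absGaloisLayerRep K E.1 (toDGM D.toSystem.toD)).hV2
    letI := (D.layerRep E).hV2
    let ι : (absGaloisLayerRep K E.1 (toDGM D.toSystem.toD)).V →+ (D.layerRep E).V :=
      AddMonoidHom.mk' (fun w => ⟨LCarrier.val D.toSystem.toD w.1, fun n =>
        congrArg (LCarrier.val D.toSystem.toD) (w.2 ⟨n.1, mem_absGaloisFixingSubgroup_of_mem E n.2⟩)⟩) fun _ _ => rfl
    have hsmul : ∀ (c : ℤ) (w : (absGaloisLayerRep K E.1 (toDGM D.toSystem.toD)).V), ι (c • w) = c • ι w :=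
      fun c w => map_zsmul ι c w
    refine ⟨Rep.ofHom ⟨{ toFun := ι, map_add' := fun w w' => map_add ι w w', map_smul' := hsmul }, fun g => ?_⟩,
      fun _ => rfl⟩
    induction g using QuotientGroup.induction_on with
    | H σ => exact LinearMap.ext fun w => Subtype.ext rfl
  -- the transported `2`-cocycle of `Γ_K ⧸ U_E` in `(lim S)^{U_E}` and its values
  have hval : ∀ σ τ : absoluteGaloisGroup K,
      (((mapCocycles₂ (quotEquivAbs E).symm.toMonoidHom φ b₀) (QuotientGroup.mk σ, QuotientGroup.mk τ)).1 : D.toSystem.limit) =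
        LCarrier.val D.toSystem.toD (b₀ ((σ : absoluteGaloisGroup K ⧸ absGaloisFixingSubgroup E.1),
          (τ : absoluteGaloisGroup K ⧸ absGaloisFixingSubgroup E.1))).1 := fun σ τ => by
    rw [coe_mapCocycles₂, HomDual.cochainsMap₂_apply]
    -- `(quotEquivAbs E)⁻¹ [σ]_U = [σ]_Γ` holds by `rfl` (identity on representatives)
    exact hφ _
  refine ⟨mapCocycles₂ (quotEquivAbs E).symm.toMonoidHom φ b₀, cocycles₂_ext fun q₁ q₂ => ?_⟩
  -- both cocycles have the underlying vector `b₀([σ], [τ])` at `([σ], [τ])`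
  induction q₁ using QuotientGroup.induction_on with
  | H σ =>
    induction q₂ using QuotientGroup.induction_on with
    | H τ =>
      apply Subtype.ext
      have h₁ : LCarrier.val D.toSystem.toD ((mapCocycles₂ (quotEquivAbs E).toMonoidHom (toAbsLayerHom E D.toSystem.toD)
          (mapCocycles₂ (quotEquivAbs E).symm.toMonoidHom φ b₀))
            ((σ : absoluteGaloisGroup K ⧸ absGaloisFixingSubgroup E.1), (τ : absoluteGaloisGroup K ⧸ absGaloisFixingSubgroup E.1))).1 =
          ((mapCocycles₂ (quotEquivAbs E).symm.toMonoidHom φ b₀) (QuotientGroup.mk σ, QuotientGroup.mk τ)).1 := by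
        rw [coe_mapCocycles₂, HomDual.cochainsMap₂_apply]
        rfl
      exact h₁.trans (hval σ τ)

/-! ## §2 The `γ`-side of an `α`-cocycle and the values of its inflation -/

set_option maxHeartbeats 800000 in
-- (as above)
/-- **The triangle over a layer `E`, for an `α`-cocycle `bα`.**  There is a `γ`-cocycle `b` of `Gal(E/K)` in `S_E` with
`iso_E [bα] = [b]` (door-c5's `layerCohomologyIso`, cocycle formula `GalLayerData.exists_layerCohomologyIso_hom_H2π_eq`), and the
inflation to `Γ_K` of door-c6's transport cocycle of `bα` has the values `[b(σ|_E, τ|_E)]_E` ON THE NOSE.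
[cite: SerreGaloisCohomology1997, I §2.2 Proposition 8][cite: CasselsFrohlichANT1967, Ch. VII §8 Prop. 8.1, §9.7] -/
theorem exists_layerCocycle_of_layerRepCocycle [FiniteDimensional K E.1] (bα : cocycles₂ (D.layerRep E)) :
    ∃ b : cocycles₂ (D.obj E), (D.layerCohomologyIso E 2).hom (H2π _ bα) = H2π _ b ∧
      ∀ σ τ : absoluteGaloisGroup K,
        (inflateTwoCocycle K E.1 (toDGM D.toSystem.toD)
            (mapCocycles₂ (quotEquivAbs E).toMonoidHom (toAbsLayerHom E D.toSystem.toD) bα)).1 (σ, τ) =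
          LCarrier.of D.toSystem.toD (D.toSystem.of E (b (E.restrictHom σ, E.restrictHom τ))) := by
  obtain ⟨b, hb, hbval⟩ := D.exists_layerCohomologyIso_hom_H2π_eq E bα
  refine ⟨b, hb, fun σ τ => ?_⟩
  -- the value of door-c6's transport cocycle at `([σ], [τ])` is the vector `bα([σ]_U, [τ]_U)`
  have h₁ : LCarrier.val D.toSystem.toD ((mapCocycles₂ (quotEquivAbs E).toMonoidHom (toAbsLayerHom E D.toSystem.toD) bα)
      ((σ : absoluteGaloisGroup K ⧸ absGaloisFixingSubgroup E.1), (τ : absoluteGaloisGroup K ⧸ absGaloisFixingSubgroup E.1))).1 =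
      (bα (QuotientGroup.mk σ, QuotientGroup.mk τ)).1 := by
    rw [coe_mapCocycles₂, HomDual.cochainsMap₂_apply]
    rfl
  rw [inflateTwoCocycle_apply, hbval]
  -- (`simp only`, not `rw`: see `…IdeleDescent` §1)
  simp only [GalLayer.quotEquiv_symm_restrictHom]
  exact (congrArg (LCarrier.of D.toSystem.toD) ((D.of_layerEquiv E _).trans h₁.symm)).symm

/-- **`infTwo (toAbsLayer E _ 2 [bα])` is the class of the inflation of door-c6's transport cocycle of `bα`** (the two cocycle
formulas `LayerDelta.toAbsLayer_H2π` and `infTwo_H2π` composed). [cite: SerreGaloisCohomology1997, I §2.2 Proposition 8] -/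
theorem infTwo_toAbsLayer_H2π [FiniteDimensional K E.1] (bα : cocycles₂ (D.layerRep E)) :
    infTwo K E.1 (toDGM D.toSystem.toD) (toAbsLayer E D.toSystem.toD 2 (H2π _ bα)) =
      twoCocycleClass (toDGM D.toSystem.toD).toTopRep (inflateTwoCocycle K E.1 (toDGM D.toSystem.toD)
        (mapCocycles₂ (quotEquivAbs E).toMonoidHom (toAbsLayerHom E D.toSystem.toD) bα)) :=
  (congrArg (infTwo K E.1 (toDGM D.toSystem.toD)) (toAbsLayer_H2π E D.toSystem.toD bα)).trans (infTwo_H2π K E.1 _ _)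

/-! ## §3 The descent triangle -/

omit [Normal K E.1] in
set_option maxHeartbeats 800000 in
-- (the rewrites in the layer-module currency are slow: as in `…IdeleDescent` §1, `…ClassInvariant` §1)
/-- **DESCENT, `α/β/γ` form (Serre CG I §2.2 Prop. 8 in degree `2` on door-c5's layer system).**  Every class
`x ∈ H²_cont(Γ_K, lim→_E S_E)` is `infTwo (toAbsLayer E _ 2 w)` for a finite Galois layer `E/K` and a class
`w ∈ H²(Γ_K ⧸ U_E, (lim→ S)^{U_E})` (door-c4's layer — the currency of `j^{U_E}_*`, `stepG` and (T-C)), and comes WITH a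
`2`-cocycle `b` of `Gal(E/K)` in `S_E` such that `iso_E w = [b]` (door-c5) and a continuous representative `Z` of `x` whose values
are `Z(σ, τ) = [b(σ|_E, τ|_E)]_E` on the nose (the input of the local dictionaries of `…IdeleDescent` §3 / `…IdeleInvariantSum`).
(Uniform local constancy of a representing cocycle gives the layer, `exists_infTwo_eq_of_discrete`; the `β`-cocycle is an
`α`-cocycle by §1; its `γ`-side and values by §2.)
[cite: SerreGaloisCohomology1997, I §2.2 Prop. 8 and Cor. 1][cite: CasselsFrohlichANT1967, Ch. VII §8 Prop. 8.1, §9.7, §11.1] -/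
theorem exists_galLayer_layerRep_triangle (x : galoisCohomology (toDGM D.toSystem.toD) 2) :
    ∃ (E : GalLayer K) (w : groupCohomology (D.layerRep E) 2) (b : cocycles₂ (D.obj E))
      (Z : contTwoCocycles (toDGM D.toSystem.toD).toTopRep),
      (haveI := normal_layer E; haveI := finiteDimensional_layer E;
        infTwo K E.1 (toDGM D.toSystem.toD) (toAbsLayer E D.toSystem.toD 2 w)) = x ∧
        (D.layerCohomologyIso E 2).hom w = H2π (D.obj E) b ∧
          twoCocycleClass (toDGM D.toSystem.toD).toTopRep Z = x ∧
            ∀ σ τ : absoluteGaloisGroup K,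
              Z.1 (σ, τ) = LCarrier.of D.toSystem.toD (D.toSystem.of E (b (E.restrictHom σ, E.restrictHom τ))) := by
  obtain ⟨E₀, hfd, hgal, y, hy⟩ := exists_infTwo_eq_of_discrete K (toDGM D.toSystem.toD) x
  let E : GalLayer K := ⟨E₀, hfd, hgal⟩
  haveI : Normal K E.1 := normal_layer E
  haveI : FiniteDimensional K E.1 := hfd
  induction y using H2_induction_on with
  | h b₀ =>
    obtain ⟨bα, hα⟩ := exists_layerRep_cocycle_mapCocycles₂_eq D E b₀
    obtain ⟨b, hαγ, hval⟩ := exists_layerCocycle_of_layerRepCocycle D E bα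
    -- `x = infTwo [b₀] = infTwo [transport cocycle of bα]`
    have hy' : infTwo K E.1 (toDGM D.toSystem.toD) (H2π (absGaloisLayerRep K E.1 (toDGM D.toSystem.toD))
        (mapCocycles₂ (quotEquivAbs E).toMonoidHom (toAbsLayerHom E D.toSystem.toD) bα)) = x :=
      (congrArg (fun c => infTwo K E.1 (toDGM D.toSystem.toD) (H2π (absGaloisLayerRep K E.1 (toDGM D.toSystem.toD)) c))
        hα).trans hy
    exact ⟨E, H2π _ bα, b, inflateTwoCocycle K E.1 (toDGM D.toSystem.toD)
        (mapCocycles₂ (quotEquivAbs E).toMonoidHom (toAbsLayerHom E D.toSystem.toD) bα),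
      (infTwo_toAbsLayer_H2π D E bα).trans ((infTwo_H2π K E.1 _ _).symm.trans hy'), hαγ,
      (infTwo_H2π K E.1 _ _).symm.trans hy', hval⟩

/-! ## §4 The case `S = J` (idèles), in the binder shapes of `…ShaTwoCochainClassInflation.ideleSide_identification` -/

omit [Normal K E.1] in
set_option maxHeartbeats 800000 in
-- (as above)
/-- **DESCENT TRIANGLE for `x ∈ H²_cont(Γ_K, J̄)`** (`D := ideleData K`; `(ideleData K).toSystem.toD = ideleBarD K` and
`(ideleData K).obj E = ideleRep K E` definitionally): a layer `E`, a class `w ∈ H²(Γ_K ⧸ U_E, J̄^{U_E})` with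
`inf_E (toAbsLayer_E w) = x` — the hypothesis `hx` of w5 g6's `ShaTwoCochain.ideleSide_identification` —, a `2`-cocycle `b` of
`Gal(E/K)` in `J_E` with `iso_J w = [b]`, and a continuous representative `Z` of `x` with `Z(σ, τ) = [b(σ|_E, τ|_E)]_E` on the nose —
the hypotheses `hZ₀`, `hval` of `ShaTwoCochain.brauerInvariant_eq_localInv_of_descended` /
`twoCocycleClass_eq_zero_iff_localInvInf_of_descended` (`…ShaTwoCochainIdeleInvariantSum.lean`).
[cite: SerreGaloisCohomology1997, I §2.2 Prop. 8 and Cor. 1][cite: CasselsFrohlichANT1967, Ch. VII §8 Prop. 8.1, §9.7, §11.1–11.2] -/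
theorem exists_galLayer_layerRep_triangle_idele (x : galoisCohomology (toDGM (ideleBarD K)) 2) :
    ∃ (E : GalLayer K)
      (w : groupCohomology ((invariantsQuotFunctor ℤ (E.openNormalSubgroup : Subgroup (absoluteGaloisGroup K))).obj
        (ideleBarD K)) 2)
      (b : cocycles₂ ((ideleData K).obj E)) (Z : contTwoCocycles (toDGM (ideleBarD K)).toTopRep),
      (haveI := normal_layer E; haveI := finiteDimensional_layer E;
        infTwo K E.1 (toDGM (ideleBarD K)) (toAbsLayer E (ideleBarD K) 2 w)) = x ∧
        ((ideleData K).layerCohomologyIso E 2).hom w = H2π ((ideleData K).obj E) b ∧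
          twoCocycleClass (toDGM (ideleBarD K)).toTopRep Z = x ∧
            ∀ σ τ : absoluteGaloisGroup K,
              Z.1 (σ, τ) = LCarrier.of (ideleBarD K) ((ideleData K).toSystem.of E (b (E.restrictHom σ, E.restrictHom τ))) :=
  exists_galLayer_layerRep_triangle (ideleData K) x

end Summit.BirchSwinnertonDyer.BirchSwinnertonDyer.Theorems.ShaTwoCochain

end
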